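import Literature.MathematicalPhysics.QuantumFieldTheory.Balaban1983to89.B9Thm34GConcrete
import Literature.MathematicalPhysics.QuantumFieldTheory.Balaban1983to89.B9Thm34GEntries342
import Literature.MathematicalPhysics.QuantumFieldTheory.Balaban1983to89.B6RandomWalkSection

/-!
# `Balaban1983to89.B9Thm34GCoarseBlk` — [Balaban1985BackgroundPropagators] Theorem 3.4 p. 400, the `G`-CLAUSE with the coarse-lattice letters in
# their own typing, ON A GENERAL FINITE BLOCK CARRIER `(P, blkP, rep)` — the append-only twin of r06's FILE 18
# `B9Thm34GCoarse.thm34_G_clause_coarseLetters` asked for by the N06 frames (cell `pub-ymgap`, dag-n06-c OBS-2 / R-Ker-2; lit-balaban RULING #8):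
# the block carrier of `C⁻¹ = (Q′G′²Q′*)⁻¹`, `C⁻¹(U′U)`, `C′(A)` is no longer the scalar `𝔅 = g.Site` with the identity block map but ANY type `P`
# with a block map `blkP : P → 𝔅` and an injective, block-compatible section `rep : P → S × ι` (`blk (rep p).1 = blkP p`) — e.g. `P = 𝔅 × ι′`
# for an `𝔸`-valued averaging letter in real coordinates (def-Y's `CY`) — and Theorem 3.2's (3.48) enters as a [4] (2.51) BLOCK MAJORANT over
# `blkP` (the currency of r06's R-Ker-1 clause `B9Thm34InvBlk.thm34_Cinv_uniform_blk`) instead of the printed kernel form on 𝔅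

statement-level skeleton of published theorems with citation tags; proofs where landed; nothing here is a claim about the Yang–Mills mass gap

CITATION HEADER (lean-in-tree rule).  B9 = T. Bałaban, *Propagators for lattice gauge theories in a background field*, Commun. Math. Phys.
**99** (1985) 389–434 [Balaban1985BackgroundPropagators] (held `paper:balaban1985-cmp99-background-propagators`; journal page = PDF page + 388):
Thm 3.4 p. 400; p. 403 l. 8–12 («The inverse satisfies Theorem 3.2 … These results imply that the operators R(U), P(U) = I − R(U) extend
analytically to the domain (3.37) and satisfy the same bounds with different constants only»); Thm 3.2 (3.48) p. 398; (3.19) p. 393, (3.21)/(3.25)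
p. 394; (3.57) p. 401, (3.59) p. 402, (3.66)–(3.68) p. 403; Thm 3.3 p. 399; (3.42) p. 397; (3.82)–(3.86) p. 407; (3.76)–(3.77) pp. 405–406;
(3.35)/(3.37) p. 396.  [4] = [Balaban1984PropagatorsII] Lemma 2.1 p. 234, (2.51)–(2.55) p. 232, (2.66) p. 234; [B11] = [Balaban1985Variational]
(135) p. 298.  Cell `lit-balaban`, seat r06 gen 68 (author lineage of FILES 15–19; R-Ker-2 FILE 1 of 3); rows B9.Thm3.4 × B9.Thm3.2 × B9.Eq3.66 ×
B9.Eq3.68 × B9.Eq3.85.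

WHY THIS FILE.  FILE 18 typed the coarse carrier as `g.Site → ℝ` (one real unknown per block) with `rep : g.Site → S × ι`; an `𝔸`-valued block
letter in real coordinates lives on `(g.Site × ι′) → ℝ` and its (3.48) datum is coordinate-diagonal per block, not a scalar kernel on 𝔅 (dag-n06-c
OBS-2, node00-def-Y: `CY` is 𝔸-valued at every regular `U ≠ 1`).  FILES 15/16 (`B9Thm34GConcrete.thm34_G_entries13_allConcrete`,
`B9Thm34GEntries342.thm34_G_entries342_allConcrete`) already read `C⁻¹`, `C⁻¹(U′U)`, `C′(A)` as SITE-ring letters with block majorants, and FILE 17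
(`B6RandomWalkSection`) is generic in the carrier `Z` of the section; so only FILE 18's binder and its three kernel-form readings change.

WHAT THIS FILE PROVES (one theorem; 0 `def`; 0 sorry; standard axioms).
* **`thm34_G_clause_coarseLetters_blk`** — FILE 18's `thm34_G_clause_coarseLetters` VERBATIM except: the section is `(blkP : P → g.Site)
  (rep : P → S × ι) (hrep : ∀ p, blk (rep p).1 = blkP p) (hinj : Function.Injective rep)` (injectivity was derived from `hrep` in the scalar
  case; here it is the displayed hypothesis «distinct unknowns sit at distinct sites»); the letters are `Qc Qc' Fc : (S × ι → ℝ) →ₗ[ℝ] (P → ℝ)`,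
  `Qcs Qcs' Fcs : (P → ℝ) →ₗ[ℝ] (S × ι → ℝ)` block-local between `blk ∘ Prod.fst` and `blkP`, `Linv Linv' Ccp : Module.End ℝ (P → ℝ)`; Theorem
  3.2's (3.48) for `C⁻¹(U)` and `C⁻¹(U′U)` and (3.66) for `C′(A)` are the BLOCK MAJORANTS `Linv ≺ B₁(Lʲη)⁻⁴e^{−δ_G d}`, `Linv' ≺ B_c′(Lʲη)⁻⁴e^{−δ_G d}`,
  `Ccp ≺ κ_Cα₁(Lʲη)⁴e^{−δ_G d}` over `blkP` ([4] (2.51); r06's dictionary `B9Thm34InvBlk.hasMajorant_blk_iff`: ℓ¹ fibre-row sums, no multiplicity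
  factor).  CONCLUSION verbatim (∃ `G(U′U)` two-sided inverse of the concrete `Δ_a(U′U)` whose `P′(A)` carries `rep_! C⁻¹ rep*`, `rep_! C⁻¹(U′U) rep*`,
  with every left and right (3.42)-entry of Theorem 3.3, FILE 16's constants).
  PROOF verbatim: FILE 17's `hasMajorant_secExt_comp` / `hasMajorant_comp_secRes` / `hasMajorant_secConj` (now at `blkZ := blkP`) / `secConj_resolvent` /
  `secRes_secExt_apply`, the word identity `G′(Q′*rep*)(rep_! C⁻¹ rep*)(rep_! Q′)G′ = G′Q′*C⁻¹Q′G′`, then FILES 15/16 BY NAME.  The kernel-to-majorant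
  step `hasMajorant_sites_of_ker` of FILE 18 disappears (the input IS the majorant).

HONEST SCOPE / NOT CLAIMED.  As FILE 18 (bookkeeping over landed modules; the rate cascade and thresholds are the callers' — FILES 19/20 twins
`B9Thm34GConcreteCBlk`, `B9Thm34GUniformBlk`); nothing of [B9] asserted beyond what FILES 15/16 prove; N06 not discharged; nothing continuum ∕ OS ∕
mass-gap ∕ Clay.  The scalar FILE 18 is the special case `P := g.Site`, `blkP := id` (its kernel-form (3.48) implies the block majorant by
`B6RandomWalkSection.hasMajorant_id_of_ker`); it is kept, not edited.

RELATED IN THE TREE, NOT DUPLICATED (2026-08-28: `rg 'coarseLetters_blk|GCoarseBlk'` over `Literature/` = ∅): FILES 15/16/17/18, `B9Thm34InvBlk` USED BY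
NAME or cited; no existing module modified.
-/

noncomputable section

namespace Literature.MathematicalPhysics.QuantumFieldTheory.Balaban1983to89.B9Thm34GCoarseBlk

open NormedSpace Complex
open Literature.MathematicalPhysics.QuantumFieldTheory.Balaban1983to89
open Literature.MathematicalPhysics.QuantumFieldTheory.Balaban1983to89.B6RandomWalk (HasMajorant hasMajorant_mono Triangle254 Ineq261)
open Literature.MathematicalPhysics.QuantumFieldTheory.Balaban1983to89.B6RandomWalkHom (HasMajorantHom hasMajorantHom_mono hasMajorantHom_iff)
open Literature.MathematicalPhysics.QuantumFieldTheory.Balaban1983to89.B9Thm34Ext (toB6)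
open Literature.MathematicalPhysics.QuantumFieldTheory.Balaban1983to89.B9Ineq347 (ScaleTransfer)
open Literature.MathematicalPhysics.QuantumFieldTheory.Balaban1983to89.B9Ineq366CPrime (hasMajorant_rate_mono)
open Literature.MathematicalPhysics.QuantumFieldTheory.Balaban1983to89.B9Eq386Neumann (vTotal vThree pTwo deltaA eq384_sub)
open Literature.MathematicalPhysics.QuantumFieldTheory.Balaban1983to89.B9Ineq377POne (kappa377 kappa377_nonneg)
open Literature.MathematicalPhysics.QuantumFieldTheory.Balaban1983to89.B9Ineq385VG (kappa385 kappa385_nonneg gExt_leftEntry_of_386)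
open Literature.MathematicalPhysics.QuantumFieldTheory.Balaban1983to89.B9Ineq386RightEntry (gExt_rightEntry_of_386L)
open Literature.MathematicalPhysics.QuantumFieldTheory.Balaban1983to89.B9Ineq386CommSum (ineq385_op_sum hasMajorant_GV_of_gradForm_comm_sum)
open Literature.MathematicalPhysics.QuantumFieldTheory.Balaban1983to89.B9Eq39Adjoint
open Literature.MathematicalPhysics.QuantumFieldTheory.Balaban1983to89.B9Eq369Small (Through)
open Literature.MathematicalPhysics.QuantumFieldTheory.Balaban1983to89.B9Eq372Locality (stBonds)
open Literature.MathematicalPhysics.QuantumFieldTheory.Balaban1983to89.B9Eq352DivForm (tauF tauB)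
open Literature.MathematicalPhysics.QuantumFieldTheory.Balaban1983to89.B9Eq352DivFormLetters
open Literature.MathematicalPhysics.QuantumFieldTheory.Balaban1983to89.B9Eq352GradLetters (diffLetter)
open Literature.MathematicalPhysics.QuantumFieldTheory.Balaban1983to89.B9Eq371GradLetters (bT bU zeroLetter V1Letter)
open Literature.MathematicalPhysics.QuantumFieldTheory.Balaban1983to89.B9Eq375GradLetters (zeroLetter₂ V1Letter₂)
open Literature.MathematicalPhysics.QuantumFieldTheory.Balaban1983to89.B9Eq372RemLetters
open Literature.MathematicalPhysics.QuantumFieldTheory.Balaban1983to89.B9Eq382V3Letters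
open Literature.MathematicalPhysics.QuantumFieldTheory.Balaban1983to89.B9Ineq385V3Concrete (cV385 cV0_nonneg cV385_nonneg)
open Literature.MathematicalPhysics.QuantumFieldTheory.Balaban1983to89.B9Eq373CurvComm (hasMajorant_comm_V₃_one)
open Literature.MathematicalPhysics.QuantumFieldTheory.Balaban1983to89.B9Ineq386V3Concrete (norm_plaqU_adjacent_of_through)
open Literature.MathematicalPhysics.QuantumFieldTheory.Balaban1983to89.B9Eq376POneLetters
open Literature.MathematicalPhysics.QuantumFieldTheory.Balaban1983to89.B9Ineq377POneConcrete (ineq377_concreteE)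
open Literature.MathematicalPhysics.QuantumFieldTheory.Balaban1983to89.B9Ineq349Hom (ineq349_hom)
open Literature.MathematicalPhysics.QuantumFieldTheory.Balaban1983to89.B9Ineq368PPrime (kappa349 kappa368)
open Literature.MathematicalPhysics.QuantumFieldTheory.Balaban1983to89.B9Ineq368PPrimeDs (kappa368Ds)
open Literature.MathematicalPhysics.QuantumFieldTheory.Balaban1983to89.B9Eq360Vprime (gPrimeExtEnd)
open Literature.MathematicalPhysics.QuantumFieldTheory.Balaban1983to89.B9Eq360VprimeLetters (vPrimeConc cBConc cCConc)
open Literature.MathematicalPhysics.QuantumFieldTheory.Balaban1983to89.B9Ineq363Vprime (cVConc theta363 thetaL363)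
open Literature.MathematicalPhysics.QuantumFieldTheory.Balaban1983to89.B9Ineq368Vprime (ineq368_op_conc ineq368_op_D_conc ineq368_op_Ds_conc
  ineq368_op_DDs_conc)
open Literature.MathematicalPhysics.QuantumFieldTheory.Balaban1983to89.B9Eq376DerivDict (hasMajorantHom_gradLin_comp hasMajorantHom_gradLin
  hasMajorantHom_comp_divLin hasMajorantHom_divLin hasMajorant_gradLin_comp_comp_divLin)
open Literature.MathematicalPhysics.QuantumFieldTheory.Balaban1983to89.B9Thm34GConcrete (thm34_G_entries13_allConcrete)
open Literature.MathematicalPhysics.QuantumFieldTheory.Balaban1983to89.B9Thm34GEntries342 (thm34_G_entries342_allConcrete)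
open Literature.MathematicalPhysics.QuantumFieldTheory.Balaban1983to89.B6RandomWalkSection
open Literature.MathematicalPhysics.QuantumFieldTheory.Balaban1983to89.B6RandomWalkHom (hasMajorantHom_zero)

section Assembly

variable {𝔸 : Type*} [NormedRing 𝔸] [NormedAlgebra ℂ 𝔸] [CompleteSpace 𝔸] {ι : Type} [Fintype ι]
variable (b : Module.Basis ι ℝ 𝔸) {S : Type} {κ : Type} [Fintype κ] [LinearOrder κ]
variable (T : κ → Equiv.Perm S) (U : κ → S → 𝔸ˣ)
variable {g : B9.Geometry} [Fintype g.Site] {Rr : ℝ} {H : Prop}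

/-- **THEOREM 3.4, `G`-CLAUSE, CONCRETE PERTURBATION, COARSE-LATTICE LETTERS ON A GENERAL BLOCK CARRIER `(P, blkP, rep)`** — existence of
`G(U′U)` as the two-sided inverse of the concrete `Δ_a(U′U)` (FILE 15) with all four (3.42)-entries of Theorem 3.3 (FILE 16), the letters
`Q′, Q′*, F′₂, F′₂*` typed between the site carrier and `P`, `C⁻¹`, `C⁻¹(U′U)` given by Theorem 3.2's (3.48) as [4] (2.51) block majorants over
`blkP`, `C′(A)` by its (3.66) block majorant over `blkP`, (3.67) on `P`, all read on the sites through the injective block-compatible section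
`rep`; `P(U) = G′Q′*C⁻¹Q′G′` the genuine two-space word.  FILE 18 `B9Thm34GCoarse.thm34_G_clause_coarseLetters` is the case `P = 𝔅`, `blkP = id`.
[cite: Balaban1985BackgroundPropagators, Thm 3.4 p.400 + Thm 3.2 (3.48) p.398 + p.403 l.8–12 + (3.19) p.393/(3.25) p.394 + (3.57) p.401/(3.59) p.402 + (3.66)–(3.67) p.403 + Thm 3.3 p.399 + (3.42) p.397 + (3.82)–(3.86) p.407 + (3.68) p.403 + (3.76)–(3.77) pp.405–406 + (3.37)/(3.35) p.396; Balaban1984PropagatorsII, Lemma 2.1 p.234 + (2.51)–(2.55) p.232 + (2.66) p.234; Balaban1985Variational, (135) p.298] -/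
theorem thm34_G_clause_coarseLetters_blk {P : Type} [Fintype S] [DecidableEq S] [DecidableEq ι] [DecidableEq g.Site] (blk : S → g.Site) (d : ℕ)
    (δ₀ δ δP δG α β ρ α' ρ₁ α'' Λ Λρ Λρ₁ B₀ κQ BG B₁ Bc' κC cF Cq a₀ κP κP' κ₁ κ₂ α₁ C₀ d₀ M₂ : ℝ)
    (kQ kF : g.Site → S → 𝔸 →L[ℝ] 𝔸) (sQ sF : S → 𝔸 →L[ℝ] 𝔸) (cfun w : g.Site → ℝ)
    (hB₀ : 0 ≤ B₀) (hκQ : 0 ≤ κQ) (hBG : 0 ≤ BG) (hB₁ : 0 ≤ B₁) (hBc' : 0 ≤ Bc') (hκC : 0 ≤ κC) (hcF : 0 ≤ cF) (hCq : 0 ≤ Cq) (ha₀ : 0 ≤ a₀) (hκP' : 0 ≤ κP') (hκ₂ : 0 ≤ κ₂) (hα₁ : 0 ≤ α₁) (hC₀ : 0 ≤ C₀) (hΛ : 1 ≤ Λ) (hΛρ : 0 ≤ Λρ)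
    (hρ : 0 ≤ ρ) (hα : 0 ≤ α) (hβ : 0 ≤ β) (hδ₀ : 0 ≤ δ₀) (hδ : 0 ≤ δ) (hM₂ : 0 ≤ M₂) (hr : ρ + (α + β) * δ₀ ≤ δ)
    (hrP : δ + 2 * ((α + β) * δ₀) ≤ δP) (hrG : δP + (2 * α + β) * δ₀ ≤ δG)
    (hr1 : ρ₁ + (α + β) * δ₀ ≤ δG) (hα''1 : α'' ≤ 1) (hα''0 : 0 ≤ α'') (hρ₁ : 0 ≤ ρ₁) (hα''ρ : 0 ≤ (1 - α'') * ρ₁)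
    (hα''ρ2 : 0 ≤ (1 - 2 * α'') * ρ₁) (hα''ρ3 : 0 ≤ (1 - 3 * α'') * ρ₁) (hΛρ₁ : 0 ≤ Λρ₁)
    (hr368 : δP + 2 * ((2 * α + β) * δ₀) ≤ B9Ineq368Vprime.rateC α'' ρ₁)
    (hκP : κP = kappa349 κQ ((1 + Fintype.card κ) * BG) B₁ Λ (B6.c1 d δ₀ β)) (hα' : α' ≤ 1) (hα'ρ0 : 0 ≤ α' * ρ) (hα'ρ2 : 0 ≤ (1 - 2 * α') * ρ)
    (hκ₁ : κ₁ = kappa377 (4 * (1 + Fintype.card κ) * (M₂ * ∑ i, ‖b i‖) * Real.exp (δP * d₀)) κP κP' Λ (B6.c1 d δ₀ β) α₁)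
    (hdnn : ∀ a a' : g.Site, 0 ≤ g.dist a a') (htri : Triangle254 (toB6 g Rr H)) (hrefl : ∀ y : g.Site, g.dist y y = 0)
    (hsym : ∀ y y' : g.Site, g.dist y y' = g.dist y' y) (hlen : ∀ y : g.Site, 0 < g.len y)
    (h261 : Ineq261 d (toB6 g Rr H) δ₀ β) (h261' : Ineq261 d (toB6 g Rr H) ρ α') (h261'' : Ineq261 d (toB6 g Rr H) ρ₁ α'')
    (hT1 : ScaleTransfer g δ₀ α Λ (fun a => g.len a)) (hT2 : ScaleTransfer g δ₀ α Λ (fun a => g.len a ^ 2))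
    (hT1i : ScaleTransfer g δ₀ α Λ (fun a => (g.len a)⁻¹)) (hT2i : ScaleTransfer g δ₀ α Λ (fun a => (g.len a ^ 2)⁻¹))
    (hT4 : ScaleTransfer g δ₀ α Λ (fun a => (g.len a ^ 4)⁻¹))
    (hTρ : ScaleTransfer g ρ α' Λρ (fun a => g.len a))
    (hTρ₁ : ScaleTransfer g ρ₁ α'' Λρ₁ (fun a => g.len a))
    (hsmall385 : kappa385 B₀
        (cV385 (Fintype.card κ) α₁ C₀ (M₂ * (∑ i, ‖b i‖) * Real.exp (δ * d₀))
          + ∑ _k ∈ (Finset.univ : Finset (κ ⊕ κ)),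
            (10 + 8 * Fintype.card κ + (16 * Fintype.card κ + 12) * C₀) * (M₂ * (∑ i, ‖b i‖) * Real.exp (δ * d₀)))
        κ₁ κ₂ Λ (B6.c1 d δ₀ β) * α₁ * B6.c1 d ρ α' < 1)
    (hrepr : ∀ (v : 𝔸) (i : ι), |b.repr v i| ≤ M₂ * ‖v‖) (hη : 0 < g.eta) (hL : 1 ≤ g.L) (A : κ → S → 𝔸)
    (hT : ∀ (μ ν : κ) (x : S), T μ (T ν x) = T ν (T μ x))
    (hsmall : ∀ y : g.Site, g.eta * (α₁ * (g.len y)⁻¹) ≤ 1 / 4)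
    (hU1 : ∀ m z, ‖((U m z : 𝔸ˣ) : 𝔸)‖ ≤ 1 ∧ ‖(((U m z)⁻¹ : 𝔸ˣ) : 𝔸)‖ ≤ 1)
    -- (3.37) for the exponent field, blockwise, in the shapes files 1–10 read it
    (h337B : ∀ ν k x, ‖((g.eta : ℂ)⁻¹) • covDstar T U ν (A k) x‖ ≤ α₁ * (g.len (blk x) ^ 2)⁻¹)
    (h337F : ∀ μ ν x, ‖((g.eta : ℂ)⁻¹) • covD T U μ (A ν) x‖ ≤ α₁ * (g.len (blk x) ^ 2)⁻¹)
    (h337B' : ∀ μ ν x, ‖((g.eta : ℂ)⁻¹) • covDstar T U ν (A ν) (T μ x)‖ ≤ α₁ * (g.len (blk x) ^ 2)⁻¹)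
    (h337Bτ : ∀ μ x, ‖((g.eta : ℂ)⁻¹) • covDstar T U μ (tauB T U μ (A μ)) x‖ ≤ α₁ * (g.len (blk x) ^ 2)⁻¹)
    (h337FB : ∀ μ ν k x, ‖((g.eta : ℂ)⁻¹) • covD T U μ (A k) ((T ν).symm x)‖ ≤ α₁ * (g.len (blk x) ^ 2)⁻¹)
    (hA : ∀ k x, ‖A k x‖ ≤ α₁ * (g.len (blk x))⁻¹) (hAτB : ∀ ν k x, ‖tauB T U ν (A k) x‖ ≤ α₁ * (g.len (blk x))⁻¹)
    (hAτF : ∀ μ k x, ‖tauF T U μ (A k) x‖ ≤ α₁ * (g.len (blk x))⁻¹)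
    (hAFB : ∀ k μ ν x, ‖A k ((T ν).symm (T μ x))‖ ≤ α₁ * (g.len (blk x))⁻¹)
    (hAst : ∀ μ x m z, (m, z) ∈ stBonds T μ x → ‖A m z‖ ≤ α₁ * (g.len (blk x))⁻¹)
    (hAloc : ∀ μ x m z, (m, z) ∈ B9Eq375Locality.locBondsA T μ x → ‖A m z‖ ≤ α₁ * (g.len (blk x))⁻¹)
    (hdAst : ∀ μ x m n y, Through T μ x m n y →
      ‖covD T U m (A n) y‖ ≤ g.eta * (α₁ * ((g.len (blk x))⁻¹) ^ 2) ∧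
        ‖covD T U n (A m) y‖ ≤ g.eta * (α₁ * ((g.len (blk x))⁻¹) ^ 2))
    -- (3.35) on the plaquettes through each bond, at that bond's block scale
    (h35 : ∀ μ x m n y, Through T μ x m n y → ‖(plaqU T U m n y : 𝔸) - 1‖ ≤ C₀ * ((g.L ^ g.scale (blk x))⁻¹) ^ 2)
    -- stencil geometry
    (hd₀B : ∀ μ x, g.dist (blk x) (blk ((T μ).symm x)) ≤ d₀) (hd₀F : ∀ μ x, g.dist (blk x) (blk (T μ x)) ≤ d₀)
    (hd₀FB : ∀ μ ν x, g.dist (blk x) (blk ((T ν).symm (T μ x))) ≤ d₀)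
    (hd₀st : ∀ μ x (q : κ × S), q ∈ stBonds T μ x → g.dist (blk x) (blk q.2) ≤ d₀)
    (hd₀loc : ∀ μ x (q : κ × S), q ∈ B9Eq375Locality.locBondsA' T μ x → g.dist (blk x) (blk q.2) ≤ d₀)
    (hd₀0 : ∀ y : g.Site, g.dist y y ≤ d₀)
    -- Theorem 3.1 (3.42)₁,₂,₃ for `G′(U)` (site endomorphism `Gp`) with the DIRECTIONAL derivative letters (p. 398: the choice `∇`/`∇*` is
    -- conventional), at the rate `δ_G`
    {Gp : Module.End ℝ (S × ι → ℝ)}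
    (h342_1 : HasMajorant (g := toB6 g Rr H) (fun p : S × ι => blk p.1) Gp
      (fun a a' => BG * g.len a ^ 2 * Real.exp (-(δG * g.dist a a'))))
    (h342_2 : ∀ k : κ ⊕ κ, HasMajorant (g := toB6 g Rr H) (fun p : S × ι => blk p.1)
      (conj b (diffLetter T U ((g.eta : ℂ)⁻¹) k) * Gp) (fun a a' => BG * g.len a * Real.exp (-(δG * g.dist a a'))))
    (h342_3 : ∀ k : κ ⊕ κ, HasMajorant (g := toB6 g Rr H) (fun p : S × ι => blk p.1)
      (Gp * conj b (diffLetter T U ((g.eta : ℂ)⁻¹) k)) (fun a a' => BG * g.len a * Real.exp (-(δG * g.dist a a'))))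
    -- THE COARSE-LATTICE LETTERS ON A GENERAL FINITE BLOCK CARRIER `P` (block map `blkP : P → 𝔅`), read on the sites through an injective,
    -- block-compatible section `rep : P → S × ι` (FILE 17 `B6RandomWalkSection`, generic in the carrier): `Q′`, `F′₂` : sites → `P` and `Q′*`,
    -- `F′₂*` : `P` → sites block-local ((3.19), (3.57), (3.59)), `C⁻¹ = (Q′G′²Q′*)⁻¹` and `C⁻¹(U′U)` by Theorem 3.2's (3.48) as [4] (2.51) BLOCK
    -- MAJORANTS over `blkP` (r06 R-Ker-1 `B9Thm34InvBlk`), `C′(A)` by its (3.66) block majorant over `blkP`, and the resolvent identity (3.67) on `P`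
    (blkP : P → g.Site) (rep : P → S × ι) (hrep : ∀ p : P, blk (rep p).1 = blkP p) (hinj : Function.Injective rep)
    {Qc Qc' Fc : (S × ι → ℝ) →ₗ[ℝ] (P → ℝ)} {Qcs Qcs' Fcs : (P → ℝ) →ₗ[ℝ] (S × ι → ℝ)}
    {Linv Linv' Ccp : Module.End ℝ (P → ℝ)}
    (h357 : Qc' = Qc + Fc) (h357s : Qcs' = Qcs + Fcs) (h367 : Linv' - Linv = -(Linv' * Ccp * Linv))
    (hQc : HasMajorantHom (g := toB6 g Rr H) (fun p : S × ι => blk p.1) blkP Qc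
      (fun a a' : g.Site => if a = a' then κQ else 0))
    (hQcs : HasMajorantHom (g := toB6 g Rr H) blkP (fun p : S × ι => blk p.1) Qcs
      (fun a a' : g.Site => if a = a' then κQ else 0))
    (hFc : HasMajorantHom (g := toB6 g Rr H) (fun p : S × ι => blk p.1) blkP Fc
      (fun a a' : g.Site => if a = a' then cF * α₁ else 0))
    (hFcs : HasMajorantHom (g := toB6 g Rr H) blkP (fun p : S × ι => blk p.1) Fcs
      (fun a a' : g.Site => if a = a' then cF * α₁ else 0))
    (h348 : HasMajorant (g := toB6 g Rr H) blkP Linv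
      (fun a a' => B₁ * g.len a ^ (-(4 : ℝ)) * Real.exp (-(δG * g.dist a a'))))
    (h348' : HasMajorant (g := toB6 g Rr H) blkP Linv'
      (fun a a' => Bc' * g.len a ^ (-(4 : ℝ)) * Real.exp (-(δG * g.dist a a'))))
    (h366 : HasMajorant (g := toB6 g Rr H) blkP Ccp
      (fun a a' => κC * α₁ * g.len a ^ 4 * Real.exp (-(δG * g.dist a a'))))
    -- the data of the CONCRETE `V′(A)` of (3.60) (`B9Eq360VprimeLetters.vPrimeConc`): averaging kernels and their sizes ((3.19), (3.59)), the
    -- `a`-weights ((3.24)), and the two smallness conditions of `B9Ineq363Vprime` («for α₁ sufficiently small», p. 402)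
    (hw : ∀ y, 0 ≤ w y) (hcard : ∀ y, ((B9Eq360Vprime.block blk y).card : ℝ) * w y ≤ 1)
    (hkQ : ∀ y x, blk x = y → ‖kQ y x‖ ≤ w y) (hkF : ∀ y x, blk x = y → ‖kF y x‖ ≤ Cq * α₁ * w y)
    (hsQ : ∀ x, ‖sQ x‖ ≤ 1) (hsF : ∀ x, ‖sF x‖ ≤ Cq * α₁) (hcfun : ∀ y, |cfun y| ≤ a₀ * (g.len y ^ 2)⁻¹)
    (hθ : theta363 (Fintype.card κ) 1 α₁ a₀ Cq M₂ (∑ i, ‖b i‖) (Real.exp (δG * d₀)) BG Λ (B6.c1 d δ₀ β) *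
      B6.c1 d ρ₁ α'' < 1)
    (hθL : thetaL363 (Fintype.card κ) 1 α₁ a₀ Cq M₂ (∑ i, ‖b i‖) (Real.exp (δG * d₀)) BG Λ (B6.c1 d δ₀ β) *
      B6.c1 d ρ₁ α'' < 1)
    -- the constant `κ_{P′}` of the (3.77)-step dominates the four explicit (3.68)-constants of `B9Ineq368Vprime`
    (hK1 : kappa368 κQ cF
        (kappa385 1 (cVConc (Fintype.card κ) 1 α₁ a₀ Cq M₂ (∑ i, ‖b i‖) (Real.exp (δG * d₀))) 0 0 Λ (B6.c1 d δ₀ β))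
        κC BG BG (BG * B6.c1 d ρ₁ α'' *
          (1 - theta363 (Fintype.card κ) 1 α₁ a₀ Cq M₂ (∑ i, ‖b i‖) (Real.exp (δG * d₀)) BG Λ (B6.c1 d δ₀ β) * B6.c1 d ρ₁ α'')⁻¹)
        B₁ Bc' Λ (B6.c1 d δ₀ β) α₁ ≤ κP')
    (hK3 : Fintype.card κ * kappa368Ds κQ cF
        (kappa385 BG (cVConc (Fintype.card κ) 1 α₁ a₀ Cq M₂ (∑ i, ‖b i‖) (Real.exp (δG * d₀))) 0 0 Λ (B6.c1 d δ₀ β))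
        κC BG BG BG (B6.c1 d ρ₁ α'' *
          (1 - theta363 (Fintype.card κ) 1 α₁ a₀ Cq M₂ (∑ i, ‖b i‖) (Real.exp (δG * d₀)) BG Λ (B6.c1 d δ₀ β) * B6.c1 d ρ₁ α'')⁻¹)
        (BG * Λρ₁ ^ 2 * B6.c1 d ρ₁ α'' *
          (1 - thetaL363 (Fintype.card κ) 1 α₁ a₀ Cq M₂ (∑ i, ‖b i‖) (Real.exp (δG * d₀)) BG Λ (B6.c1 d δ₀ β) * B6.c1 d ρ₁ α'')⁻¹)
        B₁ Bc' (cBConc (Fintype.card κ) M₂ (∑ i, ‖b i‖) (Real.exp (B9Ineq368Vprime.rateC α'' ρ₁ * d₀)))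
        (cCConc (Fintype.card κ) 1 α₁ a₀ Cq M₂ (∑ i, ‖b i‖) (Real.exp (B9Ineq368Vprime.rateC α'' ρ₁ * d₀))) Λ (B6.c1 d δ₀ β) α₁
        ≤ κP')
    -- the abstract data of (3.80), the inverse property for the concrete `DRD*` and Theorem 3.3 for G(U)
    {G P₂ Qs Qs' Q Q' a F₂ F₂s : Module.End ℝ ((κ × S) × ι → ℝ)}
    (h380 : Q' = Q + F₂) (h380s : Qs' = Qs + F₂s) (hP₂def : P₂ = pTwo Qs Q F₂ F₂s a)
    (hΔG : deltaA (conj b (lapDDLetter T ((g.eta : ℂ)⁻¹) U)) (conj b (dPrimeLetter T U g.eta))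
      (conjHom b (gradLin T ((g.eta : ℂ)⁻¹) U) ∘ₗ (1 - (Gp ∘ₗ Qcs ∘ₗ Linv ∘ₗ Qc ∘ₗ Gp)) ∘ₗ conjHom b (divLin T ((g.eta : ℂ)⁻¹) U)) Qs a Q * G = 1)
    (hGΔ : G * deltaA (conj b (lapDDLetter T ((g.eta : ℂ)⁻¹) U)) (conj b (dPrimeLetter T U g.eta))
      (conjHom b (gradLin T ((g.eta : ℂ)⁻¹) U) ∘ₗ (1 - (Gp ∘ₗ Qcs ∘ₗ Linv ∘ₗ Qc ∘ₗ Gp)) ∘ₗ conjHom b (divLin T ((g.eta : ℂ)⁻¹) U)) Qs a Q = 1)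
    (hP₂ : HasMajorant (g := toB6 g Rr H) (fun q : (κ × S) × ι => blk q.1.2) P₂
      (fun a a' => κ₂ * α₁ * (g.len a ^ 2)⁻¹ * Real.exp (-(δ * g.dist a a'))))
    (hG : HasMajorant (g := toB6 g Rr H) (fun q : (κ × S) × ι => blk q.1.2) G
      (fun a a' => B₀ * g.len a ^ 2 * Real.exp (-(δ * g.dist a a'))))
    (hDG : ∀ k : κ ⊕ κ, HasMajorant (g := toB6 g Rr H) (fun q : (κ × S) × ι => blk q.1.2)
      (conj b (diffLetter (bT T) (bU U) ((g.eta : ℂ)⁻¹) k) * G) (fun a a' => B₀ * g.len a * Real.exp (-(δ * g.dist a a'))))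
    (hGD : ∀ k : κ ⊕ κ, HasMajorant (g := toB6 g Rr H) (fun q : (κ × S) × ι => blk q.1.2)
      (G * conj b (diffLetter (bT T) (bU U) ((g.eta : ℂ)⁻¹) k)) (fun a a' => B₀ * g.len a * Real.exp (-(δ * g.dist a a')))) :
    ∃ GExt : Module.End ℝ ((κ × S) × ι → ℝ),
      deltaA (conj b (lapDDLetter T ((g.eta : ℂ)⁻¹) (prodCfg U g.eta A)))
          (conj b (dPrimeLetter T (prodCfg U g.eta A) g.eta))
          (conjHom b (gradLin T ((g.eta : ℂ)⁻¹) (prodCfg U g.eta A)) ∘ₗ (1 - ((Gp ∘ₗ Qcs ∘ₗ Linv ∘ₗ Qc ∘ₗ Gp) + (B9Eq360Vprime.pPrime Gp (gPrimeExtEnd Gp (conj b (vPrimeConc T U g.eta A blk kQ kF sQ sF cfun) * Gp)) (Qcs ∘ₗ secRes rep) (Qcs' ∘ₗ secRes rep) (secConj rep Linv) (secConj rep Linv') (secExt rep ∘ₗ Qc) (secExt rep ∘ₗ Qc'))))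
            ∘ₗ conjHom b (divLin T ((g.eta : ℂ)⁻¹) (prodCfg U g.eta A))) Qs' a Q' * GExt = 1 ∧
      GExt *
      deltaA (conj b (lapDDLetter T ((g.eta : ℂ)⁻¹) (prodCfg U g.eta A)))
          (conj b (dPrimeLetter T (prodCfg U g.eta A) g.eta))
          (conjHom b (gradLin T ((g.eta : ℂ)⁻¹) (prodCfg U g.eta A)) ∘ₗ (1 - ((Gp ∘ₗ Qcs ∘ₗ Linv ∘ₗ Qc ∘ₗ Gp) + (B9Eq360Vprime.pPrime Gp (gPrimeExtEnd Gp (conj b (vPrimeConc T U g.eta A blk kQ kF sQ sF cfun) * Gp)) (Qcs ∘ₗ secRes rep) (Qcs' ∘ₗ secRes rep) (secConj rep Linv) (secConj rep Linv') (secExt rep ∘ₗ Qc) (secExt rep ∘ₗ Qc'))))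
            ∘ₗ conjHom b (divLin T ((g.eta : ℂ)⁻¹) (prodCfg U g.eta A))) Qs' a Q' = 1 ∧
    (∀ (X : Module.End ℝ ((κ × S) × ι → ℝ)) (Pw : g.Site → ℝ), (∀ y, 0 ≤ Pw y) →
      HasMajorant (g := toB6 g Rr H) (fun q : (κ × S) × ι => blk q.1.2) (X * G)
        (fun a a' => B₀ * Pw a * Real.exp (-(δ * g.dist a a'))) →
      HasMajorant (g := toB6 g Rr H) (fun q : (κ × S) × ι => blk q.1.2) (X * GExt)
        (fun a a' => B₀ * B6.c1 d ρ α' *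
          (1 - kappa385 B₀
            (cV385 (Fintype.card κ) α₁ C₀ (M₂ * (∑ i, ‖b i‖) * Real.exp (δ * d₀))
              + ∑ _k ∈ (Finset.univ : Finset (κ ⊕ κ)),
                (10 + 8 * Fintype.card κ + (16 * Fintype.card κ + 12) * C₀) * (M₂ * (∑ i, ‖b i‖) * Real.exp (δ * d₀)))
            κ₁ κ₂ Λ (B6.c1 d δ₀ β) * α₁ * B6.c1 d ρ α')⁻¹ *
          Pw a * Real.exp (-((1 - α') * ρ * g.dist a a')))) ∧
    (∀ Y : Module.End ℝ ((κ × S) × ι → ℝ),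
      HasMajorant (g := toB6 g Rr H) (fun q : (κ × S) × ι => blk q.1.2) (G * Y)
        (fun a a' => B₀ * g.len a * Real.exp (-(δ * g.dist a a'))) →
      HasMajorant (g := toB6 g Rr H) (fun q : (κ × S) × ι => blk q.1.2) (GExt * Y)
        (fun a a' => B₀ * Λρ ^ 2 * B6.c1 d ρ α' *
          (1 - kappa385 B₀
            (cV385 (Fintype.card κ) α₁ C₀ (M₂ * (∑ i, ‖b i‖) * Real.exp (δ * d₀))
              + ∑ _k ∈ (Finset.univ : Finset (κ ⊕ κ)),
                (10 + 8 * Fintype.card κ + (16 * Fintype.card κ + 12) * C₀) * (M₂ * (∑ i, ‖b i‖) * Real.exp (δ * d₀)))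
            κ₁ κ₂ Λ (B6.c1 d δ₀ β) * α₁ * B6.c1 d ρ α')⁻¹ *
          g.len a * Real.exp (-((1 - 3 * α') * ρ * g.dist a a')))) := by
  -- the section's block-compatibility in the shape FILE 17 reads (injectivity is the hypothesis `hinj`)
  have hrep' : ∀ p : P, (fun p : S × ι => blk p.1) (rep p) = blkP p := hrep
  have hKQ : ∀ a a' : g.Site, 0 ≤ (if a = a' then κQ else 0) := fun a a' => by
    split_ifs
    · exact hκQ
    · exact le_rfl
  have hKF : ∀ a a' : g.Site, 0 ≤ (if a = a' then cF * α₁ else 0) := fun a a' => by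
    split_ifs
    · exact mul_nonneg hcF hα₁
    · exact le_rfl
  -- the coarse-lattice letters read on the sites (FILE 17): the hypotheses `hQp … hCp`, `h357p`, `h357ps`, `hCC` of FILES 15/16
  have hQp : HasMajorant (g := toB6 g Rr H) (fun p : S × ι => blk p.1) (secExt rep ∘ₗ Qc)
      (fun a a' : g.Site => if a = a' then κQ else 0) :=
    hasMajorant_secExt_comp (g := toB6 g Rr H) (blkX := fun p : S × ι => blk p.1) (blkZ := blkP) hrep' hKQ hQc
  have hQps : HasMajorant (g := toB6 g Rr H) (fun p : S × ι => blk p.1) (Qcs ∘ₗ secRes rep)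
      (fun a a' : g.Site => if a = a' then κQ else 0) :=
    hasMajorant_comp_secRes (g := toB6 g Rr H) (blkX := fun p : S × ι => blk p.1) (blkZ := blkP) hrep' hQcs
  have hFp : HasMajorant (g := toB6 g Rr H) (fun p : S × ι => blk p.1) (secExt rep ∘ₗ Fc)
      (fun a a' : g.Site => if a = a' then cF * α₁ else 0) :=
    hasMajorant_secExt_comp (g := toB6 g Rr H) (blkX := fun p : S × ι => blk p.1) (blkZ := blkP) hrep' hKF hFc
  have hFps : HasMajorant (g := toB6 g Rr H) (fun p : S × ι => blk p.1) (Fcs ∘ₗ secRes rep)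
      (fun a a' : g.Site => if a = a' then cF * α₁ else 0) :=
    hasMajorant_comp_secRes (g := toB6 g Rr H) (blkX := fun p : S × ι => blk p.1) (blkZ := blkP) hrep' hFcs
  have h357p : secExt rep ∘ₗ Qc' = secExt rep ∘ₗ Qc + secExt rep ∘ₗ Fc := by rw [h357, secExt_comp_add]
  have h357ps : Qcs' ∘ₗ secRes rep = Qcs ∘ₗ secRes rep + Fcs ∘ₗ secRes rep := by rw [h357s, add_comp_secRes]
  have hCC : secConj rep Linv' - secConj rep Linv = -(secConj rep Linv' * secConj rep Ccp * secConj rep Linv) :=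
    secConj_resolvent hinj h367
  have hw4 : ∀ y : g.Site, g.len y ^ (-(4 : ℝ)) = (g.len y ^ 4)⁻¹ := fun y => by
    rw [Real.rpow_neg (hlen y).le, show (4 : ℝ) = ((4 : ℕ) : ℝ) by norm_num, Real.rpow_natCast]
  have hCinv : HasMajorant (g := toB6 g Rr H) (fun p : S × ι => blk p.1) (secConj rep Linv)
      (fun a a' => B₁ * (g.len a ^ 4)⁻¹ * Real.exp (-(δG * g.dist a a'))) := by
    have h := hasMajorant_secConj (g := toB6 g Rr H) (blkX := fun p : S × ι => blk p.1) (blkZ := blkP) hrep'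
      (fun a a' => mul_nonneg (mul_nonneg hB₁ (Real.rpow_nonneg (hlen a).le _)) (Real.exp_nonneg _)) h348
    exact hasMajorant_mono (g := toB6 g Rr H) _ h fun a a' => by rw [hw4 a]
  have hCinv' : HasMajorant (g := toB6 g Rr H) (fun p : S × ι => blk p.1) (secConj rep Linv')
      (fun a a' => Bc' * (g.len a ^ 4)⁻¹ * Real.exp (-(δG * g.dist a a'))) := by
    have h := hasMajorant_secConj (g := toB6 g Rr H) (blkX := fun p : S × ι => blk p.1) (blkZ := blkP) hrep'
      (fun a a' => mul_nonneg (mul_nonneg hBc' (Real.rpow_nonneg (hlen a).le _)) (Real.exp_nonneg _)) h348'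
    exact hasMajorant_mono (g := toB6 g Rr H) _ h fun a a' => by rw [hw4 a]
  have hCp : HasMajorant (g := toB6 g Rr H) (fun p : S × ι => blk p.1) (secConj rep Ccp)
      (fun a a' => κC * α₁ * g.len a ^ 4 * Real.exp (-(δG * g.dist a a'))) :=
    hasMajorant_secConj (g := toB6 g Rr H) (blkX := fun p : S × ι => blk p.1) (blkZ := blkP) hrep'
      (fun a a' => mul_nonneg (mul_nonneg (mul_nonneg hκC hα₁) (pow_nonneg (hlen a).le 4)) (Real.exp_nonneg _)) h366
  -- the word of `P(U)` through the section IS `G′Q′*C⁻¹Q′G′` (FILE 17 `word_secConj`, here pointwise for this bracketing)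
  have hPw : (Gp ∘ₗ (Qcs ∘ₗ secRes rep) ∘ₗ secConj rep Linv ∘ₗ (secExt rep ∘ₗ Qc) ∘ₗ Gp) = (Gp ∘ₗ Qcs ∘ₗ Linv ∘ₗ Qc ∘ₗ Gp) :=
    LinearMap.ext fun F => by simp only [LinearMap.comp_apply, secConj_def, secRes_secExt_apply hinj]
  have hΔG' : deltaA (conj b (lapDDLetter T ((g.eta : ℂ)⁻¹) U)) (conj b (dPrimeLetter T U g.eta))
      (conjHom b (gradLin T ((g.eta : ℂ)⁻¹) U) ∘ₗ (1 - (Gp ∘ₗ (Qcs ∘ₗ secRes rep) ∘ₗ secConj rep Linv ∘ₗ (secExt rep ∘ₗ Qc) ∘ₗ Gp)) ∘ₗ conjHom b (divLin T ((g.eta : ℂ)⁻¹) U)) Qs a Q * G = 1 := by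
    rw [hPw]; exact hΔG
  have hGΔ' : G * deltaA (conj b (lapDDLetter T ((g.eta : ℂ)⁻¹) U)) (conj b (dPrimeLetter T U g.eta))
      (conjHom b (gradLin T ((g.eta : ℂ)⁻¹) U) ∘ₗ (1 - (Gp ∘ₗ (Qcs ∘ₗ secRes rep) ∘ₗ secConj rep Linv ∘ₗ (secExt rep ∘ₗ Qc) ∘ₗ Gp)) ∘ₗ conjHom b (divLin T ((g.eta : ℂ)⁻¹) U)) Qs a Q = 1 := by
    rw [hPw]; exact hGΔ
  -- a dummy right letter for FILE 15's fourth conjunct (discarded; the universal right entries come from FILE 16)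
  have hGDs0 : HasMajorant (g := toB6 g Rr H) (fun q : (κ × S) × ι => blk q.1.2) (G * 0)
      (fun a a' => B₀ * g.len a * Real.exp (-(δ * g.dist a a'))) := by
    rw [mul_zero]
    exact hasMajorant_mono (g := toB6 g Rr H) _
      ((hasMajorantHom_iff (g := toB6 g Rr H) _ _ _).mp (hasMajorantHom_zero (g := toB6 g Rr H) _ _))
      fun a a' => mul_nonneg (mul_nonneg hB₀ (hlen a).le) (Real.exp_nonneg _)
  -- FILE 15: existence of the two-sided inverse; FILE 16: all its (3.42)-entries
  obtain ⟨GExt, hinvL, hinvR, -, -⟩ := thm34_G_entries13_allConcrete (Rr := Rr) (H := H) b T U blk d δ₀ δ δP δG α β ρ α' ρ₁ α'' Λ Λρ Λρ₁ B₀ κQ BG B₁ Bc' κC cF Cq a₀ κP κP' κ₁ κ₂ α₁ C₀ d₀ M₂ kQ kF sQ sF cfun w hB₀ hκQ hBG hB₁ hBc' hκC hcF hCq ha₀ hκP' hκ₂ hα₁ hC₀ hΛ hΛρ hρ hα hβ hδ₀ hδ hM₂ hr hrP hrG hr1 hα''1 hα''0 hρ₁ hα''ρ hα''ρ2 hα''ρ3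 hΛρ₁ hr368 hκP hα' hα'ρ0 hα'ρ2 hκ₁ hdnn htri hrefl hsym hlen h261 h261' h261'' hT1 hT2 hT1i hT2i hT4 hTρ hTρ₁ hsmall385 hrepr hη hL A hT hsmall hU1 h337B h337F h337B' h337Bτ h337FB hA hAτB hAτF hAFB hAst hAloc hdAst h35 hd₀B hd₀F hd₀FB hd₀st hd₀loc hd₀0 h342_1 h342_2 h342_3 h357p h357ps hCC hQp hQps hFp hFps hCinv hCinv' hCp hw hcard hkQ hkF hsQ hsF hcfun hθ hθL hK1 hK3 h380 h380s hP₂def hΔG' hGΔ' hP₂ hG hDG hGD hGDs0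
  obtain ⟨hleft, hright⟩ := thm34_G_entries342_allConcrete (Rr := Rr) (H := H) b T U blk d δ₀ δ δP δG α β ρ α' ρ₁ α'' Λ Λρ Λρ₁ B₀ κQ BG B₁ Bc' κC cF Cq a₀ κP κP' κ₁ κ₂ α₁ C₀ d₀ M₂ kQ kF sQ sF cfun w hB₀ hκQ hBG hB₁ hBc' hκC hcF hCq ha₀ hκP' hκ₂ hα₁ hC₀ hΛ hΛρ hρ hα hβ hδ₀ hδ hM₂ hr hrP hrG hr1 hα''1 hα''0 hρ₁ hα''ρ hα''ρ2 hα''ρ3 hΛρ₁ hr368 hκP hα' hα'ρ0 hα'ρ2 hκ₁ hdnn htri hrefl hsym hlen h261 h261' h261'' hT1 hT2 hT1i hT2i hT4 hTρ hTρ₁ hsmall385 hrepr hη hL A hT hsmall hU1 h337B h337F h337B' h337Bτ h337FB hA hAτB hAτF hAFB hAst hAloc hdAst h35 hd₀B hd₀F hd₀FB hd₀st hd₀loc hd₀0 h342_1 h342_2 h342_3 h357p h357ps hCC hQp hQps hFp hFps hCinv hCinv' hCp hw hcard hkQ hkF hsQ hsF hcfun hθ hθL hK1 hK3 h380 h380s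 hP₂def hΔG' hGΔ' hP₂ hG hDG hGD hinvL hinvR
  refine ⟨GExt, ?_, ?_, hleft, hright⟩
  · rw [← hPw]; exact hinvL
  · rw [← hPw]; exact hinvR

end Assembly

end Literature.MathematicalPhysics.QuantumFieldTheory.Balaban1983to89.B9Thm34GCoarseBlk

end
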